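import Summits.Ventures.Crystal3D.Bulk.GapRhombus
import HarnessLib

/-!
# Mirror pairs in the tight graph: the kite rows R-quad-p (p-quadrilateral `p, x_a, x_b, x_e`)
# and the general mirror relation behind R-rhomb

HONEST FRAMING. Part of the venture `Summits/Ventures/Crystal3D` (cell `pub-crystal3d`, phase 2,
24-hour sprint `PLAN.md` R42/R43; seat typer-bulk-2). The census LP's row R-quad-p
(`phase2/ENV-CENSUS/DESIGN-L12-THEORY.md` §P-L4 C: "p-quadrilateral `p, x_a, x_b, x_c`
(`ρ,60,60,ρ`): the halves `p x_a x_b` and `p x_c x_b` are congruent (SSS), so `u(x_a) = u(x_c)`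
and the diagonal `p–x_b` bisects the corners at `p` and `x_b`; all four corners are explicit in
`(ρ, e)`", `e = ∠(p, x_b)`; engine-4's "kite equality" row) and, behind it and behind R-rhomb
(`Bulk/GapRhombus.lean`), ONE geometric fact in dimension three: two shell directions `u_a ≠ u_e`
both touching `u_b` (`60°`) and both at the same level `L` from a fourth direction `w`
(`w = u_d` a shell ball, `L = 1/2`: rhombus; `w = p` the hole direction, `L = D/2`: kite) are
MIRROR IMAGES in the plane through `u_b` and `w`. Proved here for EVERY admissible configuration
(face or not):

* **`IsGapConfig.mirror_relation`**: `2 (1 − y²) (⟪u_a, u_e⟫ + 1/2) = (2L − y)²`, `y = ⟪u_b, w⟫`,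
  `L = tightLevel c a d` — the closure relation (azimuths around `u_b`, `Real.cos_eq_cos_iff`);
  the kite instance **`IsGapConfig.kite_diag_relation`** (`w = p`:
  `2 (1 − ⟪u_b,p⟫²)(⟪u_a,u_e⟫ + 1/2) = (D − ⟪u_b,p⟫)²`, i.e. the corners "explicit in `(ρ, e)`");
* corner congruences from equal data: `IsGapConfig.corner_congr` (corners at two vertices with
  the same level data are equal), `IsGapConfig.corner_congr_at` (at one vertex, two partner
  pairs with the same data subtend equal corners); the kite rows **`IsGapConfig.kite_corner_eq`**
  (`u(x_a) = u(x_e)`), **`IsGapConfig.kite_bisect_shell`** (`p–x_b` bisects the corner at `x_b`),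
  **`IsGapConfig.kite_bisect_intruder`** (it bisects the corner at `p`).

Nothing is claimed about GAP(1.26).
-/

noncomputable section

open scoped BigOperators InnerProductSpace
open Finset Real

namespace Summit.Ventures.Crystal3D

open Literature.Geometry.DiscreteGeometry

variable {c : Fin 14 → EuclideanSpace ℝ (Fin 3)}

/-! ## Corner congruences from equal level data -/

/-- **Equal data, equal corners (two vertices).** If `⟪u_a, u_b⟫ = ⟪u_e, u_b⟫` and
`⟪u_a, u_d⟫ = ⟪u_e, u_d⟫` then `corner c a b d = corner c e b d` (both are the `arccos` of the
same expression in `⟪u_b, u_d⟫` and these levels). -/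
theorem IsGapConfig.corner_congr (hc : IsGapConfig c) {a e b d : Fin 14} (ha0 : a ≠ 0)
    (he0 : e ≠ 0) (hb0 : b ≠ 0) (hd0 : d ≠ 0)
    (h1 : ⟪gapDir c a, gapDir c b⟫_ℝ = ⟪gapDir c e, gapDir c b⟫_ℝ)
    (h2 : ⟪gapDir c a, gapDir c d⟫_ℝ = ⟪gapDir c e, gapDir c d⟫_ℝ) :
    corner c a b d = corner c e b d := by
  unfold corner
  rw [angle_tangentProj_eq_arccos (hc.norm_gapDir ha0) (hc.norm_gapDir hb0) (hc.norm_gapDir hd0)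
      rfl rfl rfl,
    angle_tangentProj_eq_arccos (hc.norm_gapDir he0) (hc.norm_gapDir hb0) (hc.norm_gapDir hd0)
      rfl rfl rfl, h1, h2]

/-- **Equal data, equal corners (one vertex).** At the vertex `b`, if `⟪u_b, u_a⟫ = ⟪u_b, u_e⟫`
and `⟪u_a, u_d⟫ = ⟪u_e, u_d⟫` then `corner c b a d = corner c b e d` — the arc `b–d` makes
equal angles with the arcs `b–a` and `b–e`. -/
theorem IsGapConfig.corner_congr_at (hc : IsGapConfig c) {a e b d : Fin 14} (ha0 : a ≠ 0)
    (he0 : e ≠ 0) (hb0 : b ≠ 0) (hd0 : d ≠ 0)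
    (h1 : ⟪gapDir c b, gapDir c a⟫_ℝ = ⟪gapDir c b, gapDir c e⟫_ℝ)
    (h2 : ⟪gapDir c a, gapDir c d⟫_ℝ = ⟪gapDir c e, gapDir c d⟫_ℝ) :
    corner c b a d = corner c b e d := by
  unfold corner
  rw [angle_tangentProj_eq_arccos (hc.norm_gapDir hb0) (hc.norm_gapDir ha0) (hc.norm_gapDir hd0)
      rfl rfl rfl,
    angle_tangentProj_eq_arccos (hc.norm_gapDir hb0) (hc.norm_gapDir he0) (hc.norm_gapDir hd0)
      rfl rfl rfl, h1, h2]

/-! ## The kite rows (R-quad-p) -/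

/-- **Kite: the corners at the two shell vertices adjacent to `p` are equal** (`u(x_a) = u(x_e)`).
Shell balls `a ≠ e` both touching the shell ball `b` and the intruder: `corner c a b 13 =
corner c e b 13`. -/
theorem IsGapConfig.kite_corner_eq (hc : IsGapConfig c) {a e b : Fin 14} (ha0 : a ≠ 0)
    (ha13 : a ≠ 13) (he0 : e ≠ 0) (he13 : e ≠ 13) (hb0 : b ≠ 0) (hb13 : b ≠ 13)
    (hab : dist (c a) (c b) = 1) (heb : dist (c e) (c b) = 1) (ha : dist (c a) (c 13) = 1)
    (he : dist (c e) (c 13) = 1) : corner c a b 13 = corner c e b 13 := by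
  have h13 : (13 : Fin 14) ≠ 0 := by decide
  refine hc.corner_congr ha0 he0 hb0 h13 ?_ ?_
  · rw [hc.inner_gapDir_eq ha0 hb0 hab, hc.inner_gapDir_eq he0 hb0 heb,
      tightLevel_of_ne ha13 hb13, tightLevel_of_ne he13 hb13]
  · rw [hc.inner_gapDir_eq ha0 h13 ha, hc.inner_gapDir_eq he0 h13 he, tightLevel_of_right,
      tightLevel_of_right]

/-- **Kite: the diagonal `p–x_b` bisects the corner at `x_b`**: `corner c b a 13 =
corner c b e 13`. -/
theorem IsGapConfig.kite_bisect_shell (hc : IsGapConfig c) {a e b : Fin 14} (ha0 : a ≠ 0)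
    (ha13 : a ≠ 13) (he0 : e ≠ 0) (he13 : e ≠ 13) (hb0 : b ≠ 0) (hb13 : b ≠ 13)
    (hab : dist (c a) (c b) = 1) (heb : dist (c e) (c b) = 1) (ha : dist (c a) (c 13) = 1)
    (he : dist (c e) (c 13) = 1) : corner c b a 13 = corner c b e 13 := by
  have h13 : (13 : Fin 14) ≠ 0 := by decide
  refine hc.corner_congr_at ha0 he0 hb0 h13 ?_ ?_
  · rw [real_inner_comm (gapDir c a) (gapDir c b), real_inner_comm (gapDir c e) (gapDir c b),
      hc.inner_gapDir_eq ha0 hb0 hab, hc.inner_gapDir_eq he0 hb0 heb,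
      tightLevel_of_ne ha13 hb13, tightLevel_of_ne he13 hb13]
  · rw [hc.inner_gapDir_eq ha0 h13 ha, hc.inner_gapDir_eq he0 h13 he, tightLevel_of_right,
      tightLevel_of_right]

/-- **Kite: the diagonal `p–x_b` bisects the corner at `p`**: `corner c 13 a b = corner c 13 e b`.
-/
theorem IsGapConfig.kite_bisect_intruder (hc : IsGapConfig c) {a e b : Fin 14} (ha0 : a ≠ 0)
    (ha13 : a ≠ 13) (he0 : e ≠ 0) (he13 : e ≠ 13) (hb0 : b ≠ 0) (hb13 : b ≠ 13)
    (hab : dist (c a) (c b) = 1) (heb : dist (c e) (c b) = 1) (ha : dist (c a) (c 13) = 1)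
    (he : dist (c e) (c 13) = 1) : corner c 13 a b = corner c 13 e b := by
  have h13 : (13 : Fin 14) ≠ 0 := by decide
  refine hc.corner_congr_at ha0 he0 h13 hb0 ?_ ?_
  · have h1 := hc.inner_gapDir_eq ha0 h13 ha
    have h2 := hc.inner_gapDir_eq he0 h13 he
    rw [tightLevel_of_right] at h1 h2
    rw [real_inner_comm (gapDir c a) (gapDir c 13), real_inner_comm (gapDir c e) (gapDir c 13),
      h1, h2]
  · rw [hc.inner_gapDir_eq ha0 hb0 hab, hc.inner_gapDir_eq he0 hb0 heb,
      tightLevel_of_ne ha13 hb13, tightLevel_of_ne he13 hb13]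

/-! ## The mirror relation -/

/-- The tight level seen from two shell balls is the same: `tightLevel c a d = tightLevel c e d`
for `a, e ≠ 13`. -/
theorem tightLevel_eq_of_shell {a e : Fin 14} (ha13 : a ≠ 13) (he13 : e ≠ 13)
    (c : Fin 14 → EuclideanSpace ℝ (Fin 3)) (d : Fin 14) : tightLevel c a d = tightLevel c e d := by
  unfold tightLevel; simp [ha13, he13]

/-- **The mirror relation.** For an admissible configuration (`D < 2`), shell balls `a ≠ e` both
touching the shell ball `b`, and a fourth ball `d ∉ {0, b}` touched by both `a` and `e` (a shell
ball — rhombus — or the intruder — kite): with `y = ⟪u_b, u_d⟫` and `L = tightLevel c a d` (the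
common level of `u_a, u_e` from `u_d`), `2 (1 − y²) (⟪u_a, u_e⟫ + 1/2) = (2L − y)²`. Around
`u_b`, `u_a` and `u_e` sit at level `1/2` with `cos(θ_a − θ_d) = cos(θ_e − θ_d)`; `a ≠ e` forces
the two azimuth differences to be opposite (dimension three), and
`⟪u_a, u_e⟫ = 1/4 + (3/4) cos 2(θ_a − θ_d)`. -/
theorem IsGapConfig.mirror_relation (hc : IsGapConfig c) (hD : intruderDist c < 2)
    {a b e d : Fin 14} (ha0 : a ≠ 0) (ha13 : a ≠ 13) (hb0 : b ≠ 0) (hb13 : b ≠ 13)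
    (he0 : e ≠ 0) (he13 : e ≠ 13) (hd0 : d ≠ 0) (hdb : d ≠ b) (hae : a ≠ e)
    (hab : dist (c a) (c b) = 1) (hbe : dist (c b) (c e) = 1) (had : dist (c a) (c d) = 1)
    (hed : dist (c e) (c d) = 1) :
    2 * (1 - ⟪gapDir c b, gapDir c d⟫_ℝ ^ 2) * (⟪gapDir c a, gapDir c e⟫_ℝ + 1 / 2) =
      (2 * tightLevel c a d - ⟪gapDir c b, gapDir c d⟫_ℝ) ^ 2 := by
  -- levels around `v = u_b`
  have hba : ⟪gapDir c b, gapDir c a⟫_ℝ = 1 / 2 := by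
    rw [real_inner_comm]
    have := hc.inner_gapDir_eq ha0 hb0 hab; rwa [tightLevel_of_ne ha13 hb13] at this
  have hbe' : ⟪gapDir c b, gapDir c e⟫_ℝ = 1 / 2 := by
    have := hc.inner_gapDir_eq hb0 he0 hbe; rwa [tightLevel_of_ne hb13 he13] at this
  set y := ⟪gapDir c b, gapDir c d⟫_ℝ with hy
  set L := tightLevel c a d with hL
  have hLe : tightLevel c e d = L := (tightLevel_eq_of_shell ha13 he13 c d).symm
  have hL1 : 1 / 2 ≤ L := hc.half_le_tightLevel a d
  have had' : ⟪gapDir c a, gapDir c d⟫_ℝ = L := hc.inner_gapDir_eq ha0 hd0 had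
  have hed' : ⟪gapDir c e, gapDir c d⟫_ℝ = L := by rw [← hLe]; exact hc.inner_gapDir_eq he0 hd0 hed
  have fa := hc.inner_eq_of_tightAzimuth hb0 ha0 hd0
  have fe := hc.inner_eq_of_tightAzimuth hb0 he0 hd0
  have fae := hc.inner_eq_of_tightAzimuth hb0 ha0 he0
  rw [had', hba, ← hy] at fa
  rw [hed', hbe', ← hy] at fe
  rw [hba, hbe'] at fae
  set α := tightAzimuth c b a - tightAzimuth c b d with hα
  set β := tightAzimuth c b e - tightAzimuth c b d with hβ
  -- `y² < 1`
  have hy1 : y < 1 := by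
    have := hc.inner_gapDir_le hb0 hd0 (Ne.symm hdb)
    linarith [tightLevel_lt_one hD b d]
  have hs3 : √(1 - (1 / 2 : ℝ) ^ 2) = √3 / 2 := sqrt_one_sub_half_sq
  rw [hs3] at fa fe fae
  have hy2 : -1 < y := by
    by_contra hle
    push Not at hle
    have habs := abs_real_inner_le_norm (gapDir c b) (gapDir c d)
    rw [hc.norm_gapDir hb0, hc.norm_gapDir hd0, mul_one, ← hy] at habs
    have hge := neg_le_of_abs_le habs
    have hyeq : y = -1 := le_antisymm hle hge
    rw [hyeq] at fa
    norm_num at fa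
    linarith
  have hR : 0 < 1 - y ^ 2 := by nlinarith
  have hs3sq : (√3 : ℝ) ^ 2 = 3 := Real.sq_sqrt (by norm_num)
  have hsR : (√(1 - y ^ 2)) ^ 2 = 1 - y ^ 2 := Real.sq_sqrt hR.le
  -- `cos α = cos β`
  have hcos : Real.cos α = Real.cos β := by
    have h1 : √3 / 2 * √(1 - y ^ 2) * Real.cos α = √3 / 2 * √(1 - y ^ 2) * Real.cos β := by
      linarith
    exact mul_left_cancel₀ (by positivity) h1
  obtain ⟨m, hm | hm⟩ := Real.cos_eq_cos_iff.1 hcos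
  · exfalso
    have hdiff : tightAzimuth c b e - tightAzimuth c b a = 2 * m * π := by
      linarith [hm, hα, hβ]
    have h1 := neg_pi_lt_tightAzimuth c b e
    have h2 := tightAzimuth_le_pi c b e
    have h3 := neg_pi_lt_tightAzimuth c b a
    have h4 := tightAzimuth_le_pi c b a
    have hm0 : m = 0 := by
      apply int_eq_zero_of_abs_lt_one
      · by_contra hge; push Not at hge
        have : (2 : ℝ) * π ≤ 2 * m * π := by nlinarith [Real.pi_pos]
        linarith
      · by_contra hge; push Not at hge
        have : 2 * (m : ℝ) * π ≤ -(2 * π) := by nlinarith [Real.pi_pos]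
        linarith
    have hdiff0 : tightAzimuth c b e - tightAzimuth c b a = 0 := by
      rw [hdiff, hm0]; simp
    have heq : tightAzimuth c b e = tightAzimuth c b a := by linarith
    rw [hc.tightAzimuth_eq hb0, hc.tightAzimuth_eq hb0] at heq
    have := eq_of_azimuth_eq (hv := hc.norm_gapDir hb0) (hc.norm_gapDir he0) (hc.norm_gapDir ha0)
      hbe' hba heq
    exact hc.gapDir_ne hD he0 ha0 (Ne.symm hae) this
  · have hdiff : tightAzimuth c b a - tightAzimuth c b e = 2 * α - (m : ℝ) * (2 * π) := by
      linarith [hm, hα, hβ]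
    rw [hdiff, Real.cos_sub_int_mul_two_pi, Real.cos_two_mul] at fae
    have hca : √3 * √(1 - y ^ 2) * Real.cos α = 2 * L - y := by linarith
    have hca2 : 3 * (1 - y ^ 2) * Real.cos α ^ 2 = (2 * L - y) ^ 2 := by
      have h := congrArg (fun t => t ^ 2) hca
      simp only [mul_pow, hs3sq, hsR] at h
      linarith
    have hs33 : (√3 / 2 * (√3 / 2) : ℝ) = 3 / 4 := by
      rw [div_mul_div_comm, Real.mul_self_sqrt (by norm_num)]; norm_num
    rw [hs33] at fae
    rw [fae]
    linear_combination hca2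

/-- **Kite closure relation (R-quad-p, corners explicit in `(ρ, e)`).** Shell balls `a ≠ e`
both touching the shell ball `b` and the intruder: with `y = ⟪u_b, p⟫` (`= cos e`) and
`D = intruderDist c` (`= 2 cos ρ`), `2 (1 − y²) (⟪u_a, u_e⟫ + 1/2) = (D − y)²`. -/
theorem IsGapConfig.kite_diag_relation (hc : IsGapConfig c) (hD : intruderDist c < 2)
    {a b e : Fin 14} (ha0 : a ≠ 0) (ha13 : a ≠ 13) (hb0 : b ≠ 0) (hb13 : b ≠ 13)
    (he0 : e ≠ 0) (he13 : e ≠ 13) (hae : a ≠ e) (hab : dist (c a) (c b) = 1)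
    (hbe : dist (c b) (c e) = 1) (ha : dist (c a) (c 13) = 1) (he : dist (c e) (c 13) = 1) :
    2 * (1 - ⟪gapDir c b, gapDir c 13⟫_ℝ ^ 2) * (⟪gapDir c a, gapDir c e⟫_ℝ + 1 / 2) =
      (intruderDist c - ⟪gapDir c b, gapDir c 13⟫_ℝ) ^ 2 := by
  have h := hc.mirror_relation hD ha0 ha13 hb0 hb13 he0 he13 (by decide) (Ne.symm hb13) hae hab
    hbe ha he
  rw [tightLevel_of_right] at h
  rw [h]; ring

/-- **Rhombus closure relation as an instance** (cf. `Bulk/GapRhombus.lean`): for a tight 4-cycle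
of shell balls `a–b–e–d`, `2 (1 − y²)(x + 1/2) = (1 − y)²` with `x = ⟪u_a,u_e⟫`, `y = ⟪u_b,u_d⟫`
(equivalently `(1 + x)(1 + y) = 1` since `y ≠ 1`). -/
theorem IsGapConfig.rhombus_mirror_relation (hc : IsGapConfig c) (hD : intruderDist c < 2)
    {a b e d : Fin 14} (ha0 : a ≠ 0) (ha13 : a ≠ 13) (hb0 : b ≠ 0) (hb13 : b ≠ 13)
    (he0 : e ≠ 0) (he13 : e ≠ 13) (hd0 : d ≠ 0) (hd13 : d ≠ 13) (hdb : d ≠ b) (hae : a ≠ e)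
    (hab : dist (c a) (c b) = 1) (hbe : dist (c b) (c e) = 1) (had : dist (c a) (c d) = 1)
    (hed : dist (c e) (c d) = 1) :
    2 * (1 - ⟪gapDir c b, gapDir c d⟫_ℝ ^ 2) * (⟪gapDir c a, gapDir c e⟫_ℝ + 1 / 2) =
      (1 - ⟪gapDir c b, gapDir c d⟫_ℝ) ^ 2 := by
  have h := hc.mirror_relation hD ha0 ha13 hb0 hb13 he0 he13 hd0 hdb hae hab hbe had hed
  rw [tightLevel_of_ne ha13 hd13] at h
  rw [h]; ring

end Summit.Ventures.Crystal3D
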